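import Mathlib.LinearAlgebra.Basis.VectorSpace
import Mathlib.LinearAlgebra.Dual.Lemmas
import Mathlib.LinearAlgebra.PerfectPairing.Basic
import Literature.AlgebraicTopology.SingularHomology.UniversalCoefficientsProofs
import Literature.AlgebraicTopology.SingularHomology.Coefficients
import Literature.AlgebraicTopology.SingularHomology.PoincareDuality
import HarnessLib

/-!
# Universal coefficients over a field: the Kronecker map is an isomorphism, `dim Hⁿ = bₙ`
(discharge of `isPerfPair_kroneckerPairing_of_field`)

Sibling proof file of `Literature.AlgebraicTopology.SingularHomology.UniversalCoefficients` /
`UniversalCoefficientsProofs` / `Coefficients`. A. Hatcher, *Algebraic Topology* (2002), §3.1,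
Thm. 3.2 (p. 195) with p. 198: for a field `F`, `Ext_F` vanishes and the Kronecker map
`h : Hⁿ(X; F) → Hom_F(Hₙ(X; F), F)` is an isomorphism for every space `X` and every `n`
("`Hⁿ(X; F) ≈ Hom_F(Hₙ(X; F), F)` when `F` is a field"). PROVED here:

* `kroneckerPairing_zero_injective`: in degree `0` the Kronecker map is injective over any
  commutative ring (every `0`-chain is a cycle, so a `0`-cocycle vanishing on `H₀` is zero);
* `kroneckerPairing_succ_injective_of_field`: in degree `n + 1` over a field it is injective —
  Hatcher's argument as formalised in `ker_kroneckerPairing_le_torsion`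
  (`UniversalCoefficientsProofs.lean`), with the two extension steps (`ψ : Bₙ → F` to `Zₙ`, then to
  `Cₙ`) done by `LinearMap.exists_extend` (subspaces of vector spaces are complemented), so that
  neither finite generation of `Hₙ` nor a nonzero multiplier is needed;
* `kroneckerPairing_bijective_of_field` (with `kroneckerPairing_surjective`, all degrees), the
  linear equivalence `singularCohomologyEquivDual : Hⁿ(X; F) ≃ₗ[F] Hom_F(Hₙ(X; F), F)` is NOT
  introduced as a definition (pure proof file); consumers use `LinearEquiv.ofBijective`;
* `finrank_singularCohomology_eq_bettiNumber_of_field`: `dim_F Hⁿ(X; F) = bₙ(X; F)` for every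
  space (both sides are `0` when `Hₙ(X; F)` is infinite-dimensional, `Subspace.dual_finrank_eq`),
  the form in which universal coefficients enter de Rham-type comparisons
  (`Literature.NumberTheory.Transcendental.finrank_complexDeRham_eq_bettiNumber`);
* `isPerfPair_kroneckerPairing_of_field_holds`: DISCHARGE of the named fact
  `Literature.AlgebraicTopology.SingularHomology.isPerfPair_kroneckerPairing_of_field` of
  `Coefficients.lean` (the Kronecker pairing is perfect when `Hₙ(X; F)` is finite-dimensional;
  `LinearMap.IsPerfPair.of_bijective`, reflexivity of finite-dimensional spaces).

Nothing is asserted; no statement of the vendored files is modified. Mathlib (pinned) has no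
singular (co)homology comparison; used: `LinearMap.exists_extend`, `Subspace.dual_finrank_eq`,
`LinearMap.IsPerfPair.of_bijective`.

## References

* A. Hatcher, *Algebraic Topology*, CUP 2002, §3.1, Thm. 3.2 (p. 195), pp. 198–199 (field
  coefficients: "with field coefficients, cohomology is the exact dual of homology"; "when `n = 0`
  there is no Ext term"), Cor. 3.3. [HatcherAT2002] (held as `book:hatchernd-algebraic-topology`)
-/

noncomputable section

open CategoryTheory Limits Submodule

universe u v

namespace Literature.AlgebraicTopology.SingularHomology

open singularChainComplex singularCochainComplex

/-! ### Degree `0`: the Kronecker map is injective over any ring -/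

section Zero

variable (R : Type v) [CommRing R] (X : Type u) [TopologicalSpace X]

/-- **The Kronecker map `h : H⁰(X; R) → Hom_R(H₀(X; R), R)` is injective**, for every space `X`
and every commutative ring `R` (Hatcher 2002, §3.1, Thm. 3.2 in degree `0`, where
`Ext(H₋₁, R) = 0`): every `0`-chain is a cycle, so a `0`-cocycle `φ` with `⟨[φ], -⟩ = 0` vanishes
on all of `C₀(X; R)`, i.e. `φ = 0`. PROVED. [cite: HatcherAT2002, §3.1 Thm. 3.2 (p. 195)] -/
theorem kroneckerPairing_zero_injective : Function.Injective (kroneckerPairing R R X 0) := by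
  refine (injective_iff_map_eq_zero _).mpr fun x hx ↦ ?_
  set K := singularChainComplex R R X with hK
  induction x using singularCohomology_induction_on with
  | h φc =>
    set φ : SingularSimplex X 0 → R := iCocycles R R X 0 φc with hφ
    -- every `0`-chain is a cycle, so `φ` vanishes on every `0`-chain
    have hd : ∀ c : K.X 0, (K.d 0 ((ComplexShape.down ℕ).next 0)) c = 0 := fun c ↦ by
      rw [K.shape 0 _ (fun h ↦ Nat.succ_ne_zero _ ((ComplexShape.down_Rel _ _ _).mp h))]
      rfl
    have hE : ∀ c : K.X 0,
        (Finsupp.linearCombination R φ ∘ₗ (csingularChainComplex.compInv R R X _).hom) c = 0 := by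
      intro c
      obtain ⟨z, rfl⟩ := exists_cycles_of_d_eq_zero rfl c (hd c)
      rw [hφ, ← kroneckerPairing_π_homologyπ, hx, LinearMap.zero_apply]
    have hφ0 : φ = 0 := by
      funext σ
      rw [← evalChain_single_one φ σ, hE]
      rfl
    have hc0 : φc = 0 := by
      apply (ModuleCat.mono_iff_injective (iCocycles R R X 0)).1 inferInstance
      rw [map_zero]
      exact hφ0
    rw [hc0, map_zero]

end Zero

/-! ### Positive degrees over a field -/

section Field

variable (F : Type v) [Field F] (X : Type u) [TopologicalSpace X]

/-- **The Kronecker map `h : Hⁿ⁺¹(X; F) → Hom_F(Hₙ₊₁(X; F), F)` is injective over a field**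
(Hatcher 2002, §3.1, Thm. 3.2, p. 195: `ker h = Ext(Hₙ, F)`, which vanishes over a field,
p. 198). Proof (Hatcher's, pp. 191–195, as in `ker_kroneckerPairing_le_torsion`): if the cocycle
`φ` vanishes on `Zₙ₊₁` then `φ = ψ ∘ ∂` for a functional `ψ` on `Bₙ = ∂Cₙ₊₁ ⊆ Zₙ ⊆ Cₙ`; over a
field `ψ` extends to `Zₙ` and then to `Cₙ` (`LinearMap.exists_extend`), giving an `n`-cochain
`χ'` with `δχ' = φ`, so `[φ] = 0`. PROVED. [cite: HatcherAT2002, §3.1 Thm. 3.2 (p. 195) and p. 198] -/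
theorem kroneckerPairing_succ_injective_of_field (n : ℕ) :
    Function.Injective (kroneckerPairing F F X (n + 1)) := by
  refine (injective_iff_map_eq_zero _).mpr fun x hx ↦ ?_
  set K := singularChainComplex F F X with hK
  set j := (ComplexShape.down ℕ).next n with hj
  set Z : Submodule F (K.X n) := LinearMap.ker (K.d n j).hom with hZ
  have hdd : ∀ c : K.X (n + 1), (K.d (n + 1) n).hom c ∈ Z := fun c ↦ LinearMap.mem_ker.mpr (by
    change (K.d (n + 1) n ≫ K.d n j) c = 0
    rw [K.d_comp_d]
    rfl)
  set dZ : K.X (n + 1) →ₗ[F] Z := (K.d (n + 1) n).hom.codRestrict Z hdd with hdZ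
  set B : Submodule F Z := LinearMap.range dZ with hB
  induction x using singularCohomology_induction_on with
  | h φc =>
    set φ : SingularSimplex X (n + 1) → F := iCocycles F F X (n + 1) φc with hφ
    -- `φ` vanishes on `(n+1)`-cycles
    have hE : ∀ c : K.X (n + 1), (K.d (n + 1) n).hom c = 0 →
        (Finsupp.linearCombination F φ ∘ₗ (csingularChainComplex.compInv F F X _).hom) c = 0 := by
      intro c hc
      obtain ⟨z, rfl⟩ := exists_cycles_of_d_eq_zero (ChainComplex.next_nat_succ n) c hc
      rw [hφ, ← kroneckerPairing_π_homologyπ, hx, LinearMap.zero_apply]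
    -- `ψ : Bₙ → F` with `ψ (∂c) = φ(c)`
    have hker : LinearMap.ker dZ ≤
        LinearMap.ker (Finsupp.linearCombination F φ ∘ₗ (csingularChainComplex.compInv F F X _).hom) := by
      intro c hc
      rw [LinearMap.mem_ker] at hc ⊢
      exact hE c (congrArg Subtype.val hc)
    let ψ : B →ₗ[F] F :=
      (LinearMap.ker dZ).liftQ
          (Finsupp.linearCombination F φ ∘ₗ (csingularChainComplex.compInv F F X _).hom) hker ∘ₗ
        dZ.quotKerEquivRange.symm.toLinearMap
    have hψ : ∀ c : K.X (n + 1), ψ ⟨dZ c, LinearMap.mem_range_self dZ c⟩ =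
        (Finsupp.linearCombination F φ ∘ₗ (csingularChainComplex.compInv F F X _).hom) c := by
      intro c
      change (LinearMap.ker dZ).liftQ
        (Finsupp.linearCombination F φ ∘ₗ (csingularChainComplex.compInv F F X _).hom) hker
        (dZ.quotKerEquivRange.symm ⟨dZ c, _⟩) = _
      rw [LinearMap.quotKerEquivRange_symm_apply_image, Submodule.mkQ_apply, Submodule.liftQ_apply]
    -- extend `ψ` to `χ : Zₙ → F` and then to `L : Cₙ → F` (vector spaces)
    obtain ⟨χ, hχ⟩ := LinearMap.exists_extend ψ
    obtain ⟨L, hL⟩ := LinearMap.exists_extend χ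
    let χ' : SingularSimplex X n → F := fun σ ↦ L (single (R := F) σ 1)
    have hχ'L : (Finsupp.linearCombination F χ' ∘ₗ (csingularChainComplex.compInv F F X _).hom) = L :=
      evalChain_apply_single_one L
    have hLd : ∀ c : K.X (n + 1), L ((K.d (n + 1) n).hom c) =
        (Finsupp.linearCombination F φ ∘ₗ (csingularChainComplex.compInv F F X _).hom) c := by
      intro c
      have h1 : L ((K.d (n + 1) n).hom c) = χ ⟨(K.d (n + 1) n).hom c, hdd c⟩ := by
        rw [← hL]
        rfl
      have h2 : χ ⟨(K.d (n + 1) n).hom c, hdd c⟩ = ψ ⟨dZ c, LinearMap.mem_range_self dZ c⟩ := by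
        rw [← hχ]
        rfl
      rw [h1, h2, hψ]
    -- `δχ' = φ`
    have hδ : (singularCochainComplex F F X).d n (n + 1) χ' = φ := by
      refine singularCochainComplex.ext fun τ ↦ ?_
      rw [← evalChain_single_one ((singularCochainComplex F F X).d n (n + 1) χ') τ, ← evalChain_d,
        hχ'L]
      change L ((K.d (n + 1) n).hom (single (R := F) τ 1)) = _
      rw [hLd, evalChain_single_one]
    -- hence `[φ] = [δχ'] = 0`
    have hcyc : φc = toCocycles F F X n (n + 1) χ' := by
      apply (ModuleCat.mono_iff_injective (iCocycles F F X (n + 1))).1 inferInstance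
      change φ = (toCocycles F F X n (n + 1) ≫ iCocycles F F X (n + 1)) χ'
      rw [HomologicalComplex.toCycles_i, hδ]
    rw [hcyc]
    change (toCocycles F F X n (n + 1) ≫ (singularCochainComplex F F X).homologyπ (n + 1)) χ' = 0
    rw [HomologicalComplex.toCycles_comp_homologyπ]
    rfl

/-- **The Kronecker map is injective over a field**, in every degree (Hatcher 2002, §3.1,
Thm. 3.2 with p. 198). [cite: HatcherAT2002, §3.1 Thm. 3.2 (p. 195) and p. 198] -/
theorem kroneckerPairing_injective_of_field :
    ∀ n : ℕ, Function.Injective (kroneckerPairing F F X n)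
  | 0 => kroneckerPairing_zero_injective F X
  | n + 1 => kroneckerPairing_succ_injective_of_field F X n

/-- **Universal coefficients over a field: `h : Hⁿ(X; F) → Hom_F(Hₙ(X; F), F)` is an
isomorphism** for every space `X` and degree `n` (Hatcher 2002, §3.1, Thm. 3.2, p. 198:
`Hⁿ(X; F) ≈ Hom_F(Hₙ(X; F), F)` for a field `F`). Injectivity above, surjectivity
`kroneckerPairing_surjective` (`UniversalCoefficientsProofs.lean`). PROVED.
[cite: HatcherAT2002, §3.1 Thm. 3.2 (p. 195) and p. 198] -/
theorem kroneckerPairing_bijective_of_field (n : ℕ) :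
    Function.Bijective (kroneckerPairing F F X n) :=
  ⟨kroneckerPairing_injective_of_field F X n, kroneckerPairing_surjective F X n⟩

/-- **`dim_F Hⁿ(X; F) = bₙ(X; F)`** for a field `F` and every space `X`: cohomological and
homological Betti numbers agree (Hatcher 2002, §3.1, Thm. 3.2 / p. 198 with Cor. 3.3: over a
field `Hⁿ ≅ Hom(Hₙ, F)`, and `dim Hom_F(V, F) = dim V`; when `Hₙ(X; F)` is infinite-dimensional
both `Module.finrank`s are `0`). This is the form in which universal coefficients enter the
de Rham comparison `dim H^k_dR(M; ℂ) = b_k(M; ℂ)`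
(`Literature.NumberTheory.Transcendental.finrank_complexDeRham_eq_bettiNumber`). PROVED.
[cite: HatcherAT2002, §3.1 Thm. 3.2 and Cor. 3.3] -/
theorem finrank_singularCohomology_eq_bettiNumber_of_field (n : ℕ) :
    Module.finrank F (singularCohomology F F X n) = bettiNumber F X n := by
  rw [(LinearEquiv.ofBijective _ (kroneckerPairing_bijective_of_field F X n)).finrank_eq]
  exact Subspace.dual_finrank_eq

end Field

/-! ### Discharge of `isPerfPair_kroneckerPairing_of_field` -/

/-- **Discharge of the named fact `isPerfPair_kroneckerPairing_of_field`** (`Coefficients.lean`;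
Hatcher 2002, §3.1, Thm. 3.2 with `Ext` vanishing over a field, p. 198): for a field `F` and
`Hₙ(X; F)` finite-dimensional, the Kronecker pairing `Hⁿ(X; F) × Hₙ(X; F) → F` is perfect — the
Kronecker map is bijective (`kroneckerPairing_bijective_of_field`) and a finite-dimensional space
is reflexive (`LinearMap.IsPerfPair.of_bijective`). PROVED. [cite: HatcherAT2002, §3.1 Thm. 3.2 (p. 195) and p. 198] -/
theorem isPerfPair_kroneckerPairing_of_field_holds : isPerfPair_kroneckerPairing_of_field.{u, v} := by
  intro F _ X _ n _
  exact LinearMap.IsPerfPair.of_bijective _ (kroneckerPairing_bijective_of_field F X n)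

end Literature.AlgebraicTopology.SingularHomology

end
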